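import Literature.Probability.Process.StoppedMartingale
import Literature.Probability.Process.ContinuousHitting
import Literature.Probability.Process.ItoCalculus
import Literature.Probability.Process.LevyCharacterisation
import Mathlib.Probability.Martingale.Basic
import HarnessLib

/-!
# Local martingales from approximating martingale observables, localised at exit times

Topic `Literature/Probability/Process`. The PROBABILISTIC half of the identification of a
driving process by the martingale-observable method (Lawler–Schramm–Werner 2004, §3;
Chelkak–Duminil-Copin–Hongler–Kemppainen–Smirnov, C. R. Math. 352 (2014), §3: "Since (5) is a
martingale … we can exchange the asymptotic expansion with the conditional expectation and
conclude that both coefficients `W_t` and `W_t² - 3t` are martingales"), in an abstract and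
LOCALISED form that needs no moment hypothesis on the process `W` and no specific observable:

* `integral_abs_condExp_sub_le_of_approx` — **transfer lemma**: if an a.e. martingale `Y`
  satisfies `Y_t = a A + b + O(δ)`, `Y_s = a B + b + O(δ)` a.e. (`a ≠ 0`), then
  `∫ |E[A | 𝓕_s] - B| ≤ 2δ/|a|` (`L¹`-contractivity of conditional expectation);
  `condExp_ae_eq_of_forall_integral_abs_le` concludes when `δ → 0`.
* Localisation by the **exit times `σ_K` of `W` from `(-K, K)`** (`Process.exitTime`, a stopping
  time of the raw filtration for a continuous adapted process): `exitTime_mono_interval`,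
  `tendsto_exitTime_nat_atTop`, `isLocalizingSequence_exitTime` (`σ_{n+1}` is a localizing
  sequence in Mathlib's sense `ProbabilityTheory.IsLocalizingSequence`), and on the paths started
  at `0` the stopped driver `W^{σ_K}` is bounded by `K` and `⊥ < σ_K`.
* `martingale_stoppedDriver_of_approx`, `martingale_stoppedQuad_of_approx` — if for every
  horizon `T` and `ε > 0` there is a continuous `𝓕`-martingale `Y` with
  `|Y_r - (a W_r + b)| ≤ ε|a|` (resp. `|Y_r - (a (W_r² - κ r) + b)| ≤ ε|a|`) a.s. for all
  `r ≤ T` such that `|W| ≤ K` on `[0, r]`, then `W^{σ_K}` (resp. `(W^{σ_K})² - κ(· ∧ σ_K)`) is an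
  `𝓕`-martingale: optional stopping of `Y` at `σ_K` (the tree's
  `Martingale.isAEMartingale_stoppedProcess`, Le Gall Cor. 3.24, raw filtration, continuous
  paths), the transfer lemma, `ε → 0`.
* `isLocalMartingale_hasQuadraticVariation_of_approx` — **Lévy's format**: under the two
  families of approximations for every level `K > 0`, `X = W/√κ` is a continuous local
  martingale with `⟨X⟩_t = t` (`RandomPlanarGeometry.IsLocalMartingale` = Mathlib `Locally`,
  `Process.HasQuadraticVariation`), i.e. exactly the input of
  `Process.levy_characterisation_holds` and of
  `RandomPlanarGeometry.isSLELaw_of_isLocalMartingale_driving_of_lt_four`.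

Hypotheses on `W` throughout: adapted (`MeasureTheory.Adapted`), everywhere-continuous paths,
`W_0 = 0` ALMOST surely (the null set where `W_0 ≠ 0` is carried along: there `σ_K` may vanish,
which is why Mathlib's indicator `𝟙_{⊥ < σ}` is kept and shown to be a.s. one).

First consumer: the continuum endgame of the line `room-entropy-wright-fisher` for the crux
`SubseqIdentification` of `SAWScalingLimit` (κ = 8/3), with the far-field expansions of
`RandomPlanarGeometry/LoewnerRoomObservableFarField.lean` as the approximating observables. The
FK-Ising and spin-Ising files (`ObservableLocalMartingale.lean`,
`SpinObservableLocalMartingale.lean`) localise instead at CDHKS's far-field stopping times; the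
present exit-time localisation is observable-independent.

## Mathlib

USED: `MeasureTheory.Martingale` (`smul`, `congr`), `condExp_sub/smul`,
`condExp_const`, `integral_abs_condExp_le`, `stoppedProcess`, `StronglyAdapted.stoppedProcess`,
`ProbabilityTheory.IsLocalizingSequence`, `ProbabilityTheory.Locally`. From the tree:
`Process.IsAEMartingale`, `Martingale.isAEMartingale_stoppedProcess`,
`IsStoppingTime.measurableSet_bot_lt` (`StoppedMartingale.lean`), `Process.exitTime` and its API
(`ContinuousHitting.lean`), `Process.coe_untopA_min_le` (`LevyCharacterisation.lean`).

## References

* D. Chelkak, H. Duminil-Copin, C. Hongler, A. Kemppainen, S. Smirnov, *Convergence of Ising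
  interfaces to Schramm's SLE curves*, C. R. Math. Acad. Sci. Paris 352 (2014) 157–161, §3.
* G. F. Lawler, O. Schramm, W. Werner, *Conformal invariance of planar loop-erased random walks
  and uniform spanning trees*, Ann. Probab. 32 (2004), §3.
* D. Revuz, M. Yor, *Continuous Martingales and Brownian Motion* (1999), Ch. IV, Def. (1.5),
  Prop. (1.7); J.-F. Le Gall, *Brownian Motion, Martingales, and Stochastic Calculus* (2016),
  Cor. 3.24, Prop. 4.7.
-/
noncomputable section

open MeasureTheory Filter Set ProbabilityTheory
open scoped NNReal ENNReal Topology

namespace Literature.Probability.Process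

variable {Ω : Type*} {m : MeasurableSpace Ω}

/-! ### Two conditional-expectation lemmas -/

section Transfer

variable {𝓕 : Filtration ℝ≥0 m} {P : Measure Ω} [IsProbabilityMeasure P]

omit [IsProbabilityMeasure P] in
/-- If the `L¹` distance between `E[X | 𝓖]` and an integrable `Z` is below every `ε > 0`, then
`E[X | 𝓖] = Z` a.e. [folklore] -/
theorem condExp_ae_eq_of_forall_integral_abs_le {𝓖 : MeasurableSpace Ω} {X Z : Ω → ℝ}
    (hZ : Integrable Z P) (h : ∀ ε : ℝ, 0 < ε → ∫ ω, |(P[X | 𝓖]) ω - Z ω| ∂P ≤ ε) :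
    P[X | 𝓖] =ᵐ[P] Z := by
  have hint : Integrable (fun ω ↦ |(P[X | 𝓖]) ω - Z ω|) P := (integrable_condExp.sub hZ).abs
  have hnn : 0 ≤ ∫ ω, |(P[X | 𝓖]) ω - Z ω| ∂P := integral_nonneg fun ω ↦ abs_nonneg _
  have h0 : ∫ ω, |(P[X | 𝓖]) ω - Z ω| ∂P = 0 := by
    refine le_antisymm ?_ hnn
    by_contra hpos
    rw [not_le] at hpos
    have := h ((∫ ω, |(P[X | 𝓖]) ω - Z ω| ∂P) / 2) (by positivity)
    linarith
  have hae := (integral_eq_zero_iff_of_nonneg (fun ω ↦ abs_nonneg _) hint).1 h0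
  filter_upwards [hae] with ω hω
  simpa [sub_eq_zero] using hω

/-- **Transfer of the martingale identity through an affine approximation.** Let `Y` be an a.e.
martingale, `s ≤ t`, and suppose that `Y_t = a A + b + e_t`, `Y_s = a B + b + e_s` with a.e.
errors `|e_t|, |e_s| ≤ δ` and `a ≠ 0`. Then `∫ |E[A | 𝓕_s] - B| ≤ 2δ/|a|`: the martingale
terms cancel and conditional expectation contracts `L¹`. This is the rigorous form of
"exchanging the asymptotic expansion with the conditional expectation" (Chelkak–Duminil-Copin–
Hongler–Kemppainen–Smirnov 2014, §3). [folklore] -/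
theorem integral_abs_condExp_sub_le_of_approx {Y : ℝ≥0 → Ω → ℝ} (hY : IsAEMartingale Y 𝓕 P)
    {s t : ℝ≥0} (hst : s ≤ t) {A B : Ω → ℝ} (hA : Integrable A P) (hB : Integrable B P)
    {a b δ : ℝ} (ha : a ≠ 0) (htA : ∀ᵐ ω ∂P, |Y t ω - (a * A ω + b)| ≤ δ)
    (hsB : ∀ᵐ ω ∂P, |Y s ω - (a * B ω + b)| ≤ δ) :
    ∫ ω, |(P[A | 𝓕 s]) ω - B ω| ∂P ≤ 2 * δ / |a| := by
  set et : Ω → ℝ := fun ω ↦ Y t ω - (a * A ω + b) with het_def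
  set es : Ω → ℝ := fun ω ↦ Y s ω - (a * B ω + b) with hes_def
  have hYt := hY.integrable t
  have heti : Integrable et P := hYt.sub ((hA.const_mul a).add (integrable_const b))
  have hesi : Integrable es P := (hY.integrable s).sub ((hB.const_mul a).add (integrable_const b))
  -- `a A = Y t - et - b`
  have hA_eq : (fun ω ↦ a * A ω) = Y t - et - fun _ ↦ b := by
    funext ω; simp only [Pi.sub_apply, het_def]; ring
  have h1 : P[fun ω ↦ a * A ω | 𝓕 s] =ᵐ[P] fun ω ↦ a * (P[A | 𝓕 s]) ω := by
    have h3 : (fun ω ↦ a * A ω) = a • A := by ext ω; simp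
    rw [h3]
    filter_upwards [condExp_smul a A (𝓕 s) (μ := P)] with ω hω
    simp [hω]
  have h2 : P[fun ω ↦ a * A ω | 𝓕 s] =ᵐ[P] P[Y t | 𝓕 s] - P[et | 𝓕 s] - fun _ ↦ b := by
    rw [hA_eq]
    refine (condExp_sub (hYt.sub heti) (integrable_const b) _).trans ?_
    have hc : P[(fun _ ↦ b : Ω → ℝ) | 𝓕 s] = fun _ ↦ b := condExp_const (𝓕.le s) b
    filter_upwards [condExp_sub hYt heti (𝓕 s)] with ω hω
    simp only [Pi.sub_apply] at hω ⊢
    rw [hω, hc]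
  have hkey : ∀ᵐ ω ∂P, a * ((P[A | 𝓕 s]) ω - B ω) = es ω - (P[et | 𝓕 s]) ω := by
    filter_upwards [h1, h2, hY.condExp_ae_eq s t hst] with ω hω1 hω2 hω3
    simp only [Pi.sub_apply] at hω2
    rw [mul_sub, ← hω1, hω2, hω3, hes_def]
    ring
  have hδ : 0 ≤ δ := by
    obtain ⟨ω, hω⟩ := htA.exists
    exact (abs_nonneg _).trans hω
  have habs : ∫ ω, |a * ((P[A | 𝓕 s]) ω - B ω)| ∂P ≤ 2 * δ := by
    calc ∫ ω, |a * ((P[A | 𝓕 s]) ω - B ω)| ∂P = ∫ ω, |es ω - (P[et | 𝓕 s]) ω| ∂P :=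
          integral_congr_ae (by filter_upwards [hkey] with ω hω; rw [hω])
      _ ≤ ∫ ω, (|es ω| + |(P[et | 𝓕 s]) ω|) ∂P :=
          integral_mono (hesi.sub integrable_condExp).abs (hesi.abs.add integrable_condExp.abs)
            fun ω ↦ abs_sub _ _
      _ = ∫ ω, |es ω| ∂P + ∫ ω, |(P[et | 𝓕 s]) ω| ∂P := integral_add hesi.abs integrable_condExp.abs
      _ ≤ ∫ ω, |es ω| ∂P + ∫ ω, |et ω| ∂P := add_le_add_right (integral_abs_condExp_le et) _
      _ ≤ δ + δ := by
          gcongr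
          · calc ∫ ω, |es ω| ∂P ≤ ∫ _, δ ∂P := integral_mono_ae hesi.abs (integrable_const δ) hsB
              _ = δ := by simp
          · calc ∫ ω, |et ω| ∂P ≤ ∫ _, δ ∂P := integral_mono_ae heti.abs (integrable_const δ) htA
              _ = δ := by simp
      _ = 2 * δ := by ring
  have ha0 : 0 < |a| := abs_pos.2 ha
  rw [le_div_iff₀ ha0]
  calc (∫ ω, |(P[A | 𝓕 s]) ω - B ω| ∂P) * |a| = ∫ ω, |a * ((P[A | 𝓕 s]) ω - B ω)| ∂P := by
        rw [← integral_mul_const]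
        refine integral_congr_ae (ae_of_all _ fun ω ↦ ?_)
        show |_| * |a| = |a * _|
        rw [abs_mul, mul_comm]
    _ ≤ 2 * δ := habs

end Transfer

/-! ### Localisation by the exit times of `W` from `(-K, K)` -/

section ExitLocalisation

variable {W : ℝ≥0 → Ω → ℝ}

/-- Exit times are monotone in the interval: leaving a larger interval takes longer (Mathlib
`hittingAfter_anti`). [folklore] -/
theorem exitTime_mono_interval {a a' b b' : ℝ} (ha : a' ≤ a) (hb : b ≤ b') (ω : Ω) :
    exitTime W a b ω ≤ exitTime W a' b' ω :=
  hittingAfter_anti W 0 (compl_subset_compl.2 (Ioo_subset_Ioo ha hb)) ω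

/-- Along a continuous path the exit times from `(-(n+1), n+1)` tend to `⊤` (the path is bounded
on every compact time interval). [folklore] -/
theorem tendsto_exitTime_nat_atTop {ω : Ω} (hWc : Continuous (W · ω)) :
    Tendsto (fun n : ℕ ↦ exitTime W (-((n : ℝ) + 1)) ((n : ℝ) + 1) ω) atTop (𝓝 ⊤) := by
  rw [tendsto_order]
  refine ⟨fun a ha ↦ ?_, fun a ha ↦ absurd ha (not_lt.2 le_top)⟩
  obtain ⟨t, rfl⟩ := WithTop.ne_top_iff_exists.1 ha.ne
  obtain ⟨B, hB⟩ : ∃ B, ∀ r ∈ Set.Icc (0 : ℝ≥0) t, |W r ω| ≤ B := by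
    obtain ⟨B, hB⟩ := ((isCompact_Icc (a := (0 : ℝ≥0)) (b := t)).image_of_continuousOn
      (continuous_abs.comp hWc).continuousOn).isBounded.bddAbove
    exact ⟨B, fun r hr ↦ hB ⟨r, hr, rfl⟩⟩
  obtain ⟨N, hN⟩ := exists_nat_ge B
  refine eventually_atTop.2 ⟨N, fun n hn ↦ ?_⟩
  rw [lt_iff_not_ge]
  intro hle
  obtain ⟨j, hj, hjmem⟩ := (exitTime_le_coe_iff hWc).1 hle
  have hjB := abs_le.1 (hB j ⟨bot_le, hj⟩)
  have hn' : (N : ℝ) ≤ n := by exact_mod_cast hn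
  rw [Set.mem_Ioo, not_and_or, not_lt, not_lt] at hjmem
  rcases hjmem with h | h <;> linarith [hjB.1, hjB.2]

variable {𝓕 : Filtration ℝ≥0 m} {P : Measure Ω}

/-- **The exit times of `W` from `(-(n+1), n+1)` form a localizing sequence** for any filtration to
which the continuous process `W` is adapted (stopping times, monotone, `→ ⊤` everywhere).
Revuz–Yor (1999), Ch. IV, proof of Prop. (1.7). [folklore] -/
theorem isLocalizingSequence_exitTime (hWad : Adapted 𝓕 W) (hWc : ∀ ω, Continuous (W · ω)) :
    IsLocalizingSequence 𝓕 (fun n : ℕ ↦ exitTime W (-((n : ℝ) + 1)) ((n : ℝ) + 1)) P where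
  isStoppingTime _ := isStoppingTime_exitTime hWad hWc
  mono := ae_of_all _ fun ω i j hij ↦ by
    have h : (i : ℝ) ≤ j := Nat.cast_le.2 hij
    exact exitTime_mono_interval (by linarith) (by linarith) ω
  tendsto_top := ae_of_all _ fun ω ↦ tendsto_exitTime_nat_atTop (hWc ω)

/-- On a path started at `0`, the driver stopped at its exit time from `(-K, K)` is bounded by `K`.
[folklore] -/
theorem abs_stoppedProcess_exitTime_le {ω : Ω} (hWc : Continuous (W · ω)) (h0 : W 0 ω = 0)
    {K : ℝ} (hK : 0 < K) (r : ℝ≥0) : |stoppedProcess W (exitTime W (-K) K) r ω| ≤ K := by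
  have h := stoppedProcess_exitTime_mem_Icc hWc (a := -K) (b := K) (by rw [h0]; exact ⟨by linarith, hK⟩) r
  exact abs_le.2 ⟨h.1, h.2⟩

/-- On a path started at `0`, the exit time from `(-K, K)` is positive (`⊥ < τ`, the event of
Mathlib's `ProbabilityTheory.Locally`). [folklore] -/
theorem bot_lt_exitTime {ω : Ω} (hWc : Continuous (W · ω)) (h0 : W 0 ω = 0) {K : ℝ}
    (hK : 0 < K) : (⊥ : WithTop ℝ≥0) < exitTime W (-K) K ω := by
  have h := exitTime_pos hWc (a := -K) (b := K) (by rw [h0]; exact ⟨by linarith, hK⟩)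
  exact lt_of_le_of_lt bot_le h

/-- The stopped clock `r ↦ r ∧ τ` (read in `ℝ`) at a stopping time is strongly adapted. [folklore] -/
theorem stronglyAdapted_stoppedClock {τ : Ω → WithTop ℝ≥0} (hτ : IsStoppingTime 𝓕 τ) :
    StronglyAdapted 𝓕 (fun (r : ℝ≥0) (ω : Ω) ↦ (((min (r : WithTop ℝ≥0) (τ ω)).untopA : ℝ≥0) : ℝ)) := by
  have hclock : StronglyAdapted 𝓕 (fun (u : ℝ≥0) (_ : Ω) ↦ (u : ℝ)) := fun _ ↦ stronglyMeasurable_const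
  exact hclock.stoppedProcess (fun _ ↦ NNReal.continuous_coe) hτ

end ExitLocalisation

/-! ### The two stopped martingales -/

section Stopped

variable {W : ℝ≥0 → Ω → ℝ} {𝓕 : Filtration ℝ≥0 m} {P : Measure Ω} [IsProbabilityMeasure P]

/-- The stopped driver at an exit time is strongly adapted. [folklore] -/
theorem stronglyAdapted_stoppedDriver (hWad : Adapted 𝓕 W) (hWc : ∀ ω, Continuous (W · ω))
    (K : ℝ) : StronglyAdapted 𝓕 (stoppedProcess W (exitTime W (-K) K)) :=
  stronglyAdapted_stoppedProcess_exitTime hWad hWc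

omit [IsProbabilityMeasure P] in
/-- The stopped driver at the exit time from `(-K, K)` is a.e. bounded by `K` (paths start at `0`
a.s.), hence integrable on a finite measure space. [folklore] -/
theorem integrable_stoppedDriver [IsFiniteMeasure P] (hWad : Adapted 𝓕 W)
    (hWc : ∀ ω, Continuous (W · ω)) (hW0 : ∀ᵐ ω ∂P, W 0 ω = 0) {K : ℝ} (hK : 0 < K) (r : ℝ≥0) :
    Integrable (stoppedProcess W (exitTime W (-K) K) r) P := by
  refine (integrable_const K).mono'
    (((stronglyAdapted_stoppedDriver hWad hWc K) r).mono (𝓕.le r)).aestronglyMeasurable ?_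
  filter_upwards [hW0] with ω hω
  rw [Real.norm_eq_abs]
  exact abs_stoppedProcess_exitTime_le (hWc ω) hω hK r

/-- **Order one, localised: the driver stopped at its exit time from `(-K, K)` is a martingale.**
Let `W` be adapted with continuous paths and `W_0 = 0` a.s. Suppose that for every horizon `T`
and every `ε > 0` there are a continuous `𝓕`-martingale `Y` and constants `a ≠ 0`, `b` with
`|Y_r - (a W_r + b)| ≤ ε |a|` a.s. for all `r ≤ T` such that `|W| ≤ K` on `[0, r]` (an
approximating martingale observable in the far field). Then `W^{σ_K}` is an `𝓕`-martingale,
`σ_K` the exit time from `(-K, K)`: optional stopping of `Y` at `σ_K`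
(`Martingale.isAEMartingale_stoppedProcess`), the transfer lemma
`integral_abs_condExp_sub_le_of_approx`, and `ε → 0`. (CDHKS 2014, §3, localised; Revuz–Yor
Ch. IV §1.) [folklore] -/
theorem martingale_stoppedDriver_of_approx (hWad : Adapted 𝓕 W) (hWc : ∀ ω, Continuous (W · ω))
    (hW0 : ∀ᵐ ω ∂P, W 0 ω = 0) {K : ℝ} (hK : 0 < K)
    (h1 : ∀ T : ℝ≥0, ∀ ε : ℝ, 0 < ε → ∃ (Y : ℝ≥0 → Ω → ℝ) (a b : ℝ), a ≠ 0 ∧ Martingale Y 𝓕 P ∧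
      (∀ ω, Continuous (Y · ω)) ∧ ∀ᵐ ω ∂P, ∀ r : ℝ≥0, r ≤ T → (∀ u, u ≤ r → |W u ω| ≤ K) →
        |Y r ω - (a * W r ω + b)| ≤ ε * |a|) :
    Martingale (stoppedProcess W (exitTime W (-K) K)) 𝓕 P := by
  set σ := exitTime W (-K) K with hσ
  set V := stoppedProcess W σ with hV
  have hσst : IsStoppingTime 𝓕 σ := isStoppingTime_exitTime hWad hWc
  have hVint : ∀ r, Integrable (V r) P := integrable_stoppedDriver hWad hWc hW0 hK
  refine ⟨stronglyAdapted_stoppedDriver hWad hWc K, fun s t hst ↦ ?_⟩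
  refine condExp_ae_eq_of_forall_integral_abs_le (hVint s) fun ε hε ↦ ?_
  obtain ⟨Y, a, b, ha, hYM, hYc, hae⟩ := h1 t (ε / 2) (by positivity)
  have hYσ : IsAEMartingale (stoppedProcess Y σ) 𝓕 P :=
    hYM.isAEMartingale_stoppedProcess (ae_of_all _ hYc) hσst.isOptionalTime
  -- the approximation at the stopped clock
  have happrox : ∀ r : ℝ≥0, r ≤ t →
      ∀ᵐ ω ∂P, |stoppedProcess Y σ r ω - (a * V r ω + b)| ≤ ε / 2 * |a| := by
    intro r hr
    filter_upwards [hae, hW0] with ω hω h0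
    set r' : ℝ≥0 := (min (r : WithTop ℝ≥0) (σ ω)).untopA with hr'
    have hr'r : r' ≤ r := untopA_min_coe_le r _
    have hr'σ : (r' : WithTop ℝ≥0) ≤ σ ω := coe_untopA_min_le r _
    have hbd : ∀ u, u ≤ r' → |W u ω| ≤ K := fun u hu ↦ by
      have hu' : (u : WithTop ℝ≥0) ≤ σ ω := (WithTop.coe_le_coe.2 hu).trans hr'σ
      have h := abs_stoppedProcess_exitTime_le (hWc ω) h0 hK u
      rwa [stoppedProcess_eq_of_le hu'] at h
    exact hω r' (hr'r.trans hr) hbd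
  have h := integral_abs_condExp_sub_le_of_approx hYσ hst (hVint t) (hVint s) ha
    (happrox t le_rfl) (happrox s hst)
  calc ∫ ω, |(P[V t | 𝓕 s]) ω - V s ω| ∂P ≤ 2 * (ε / 2 * |a|) / |a| := h
    _ = ε := by field_simp

/-- **Order two, localised: `(W^{σ_K})² - κ (· ∧ σ_K)` is a martingale**, from approximating
continuous martingales `Y ≈ a (W_r² - κ r) + b` in the far field (same mechanism as
`martingale_stoppedDriver_of_approx`). [folklore] -/
theorem martingale_stoppedQuad_of_approx (hWad : Adapted 𝓕 W) (hWc : ∀ ω, Continuous (W · ω))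
    (hW0 : ∀ᵐ ω ∂P, W 0 ω = 0) {K : ℝ} (hK : 0 < K) (κ : ℝ)
    (h2 : ∀ T : ℝ≥0, ∀ ε : ℝ, 0 < ε → ∃ (Y : ℝ≥0 → Ω → ℝ) (a b : ℝ), a ≠ 0 ∧ Martingale Y 𝓕 P ∧
      (∀ ω, Continuous (Y · ω)) ∧ ∀ᵐ ω ∂P, ∀ r : ℝ≥0, r ≤ T → (∀ u, u ≤ r → |W u ω| ≤ K) →
        |Y r ω - (a * (W r ω ^ 2 - κ * r) + b)| ≤ ε * |a|) :
    Martingale (fun r ω ↦ stoppedProcess W (exitTime W (-K) K) r ω ^ 2 -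
      κ * (((min (r : WithTop ℝ≥0) (exitTime W (-K) K ω)).untopA : ℝ≥0) : ℝ)) 𝓕 P := by
  set σ := exitTime W (-K) K with hσ
  set V := stoppedProcess W σ with hV
  set Q : ℝ≥0 → Ω → ℝ := fun r ω ↦ V r ω ^ 2 - κ * (((min (r : WithTop ℝ≥0) (σ ω)).untopA : ℝ≥0) : ℝ)
    with hQ
  have hσst : IsStoppingTime 𝓕 σ := isStoppingTime_exitTime hWad hWc
  have hVad : StronglyAdapted 𝓕 V := stronglyAdapted_stoppedDriver hWad hWc K
  have hQad : StronglyAdapted 𝓕 Q := fun r ↦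
    ((hVad r).pow 2).sub ((stronglyAdapted_stoppedClock hσst r).const_mul κ)
  have hQint : ∀ r, Integrable (Q r) P := by
    intro r
    refine (integrable_const (K ^ 2 + |κ| * r)).mono' ((hQad r).mono (𝓕.le r)).aestronglyMeasurable ?_
    filter_upwards [hW0] with ω h0
    have hVb := abs_stoppedProcess_exitTime_le (hWc ω) h0 hK r
    have hclock : (((min (r : WithTop ℝ≥0) (σ ω)).untopA : ℝ≥0) : ℝ) ≤ r := by
      exact_mod_cast untopA_min_coe_le r (σ ω)
    have hclock0 : (0 : ℝ) ≤ ((min (r : WithTop ℝ≥0) (σ ω)).untopA : ℝ≥0) := NNReal.coe_nonneg _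
    rw [Real.norm_eq_abs]
    calc |Q r ω| ≤ |V r ω ^ 2| + |κ * (((min (r : WithTop ℝ≥0) (σ ω)).untopA : ℝ≥0) : ℝ)| :=
          abs_sub _ _
      _ ≤ K ^ 2 + |κ| * r := by
          rw [abs_pow, abs_mul, abs_of_nonneg hclock0]
          gcongr
  refine ⟨hQad, fun s t hst ↦ ?_⟩
  refine condExp_ae_eq_of_forall_integral_abs_le (hQint s) fun ε hε ↦ ?_
  obtain ⟨Y, a, b, ha, hYM, hYc, hae⟩ := h2 t (ε / 2) (by positivity)
  have hYσ : IsAEMartingale (stoppedProcess Y σ) 𝓕 P :=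
    hYM.isAEMartingale_stoppedProcess (ae_of_all _ hYc) hσst.isOptionalTime
  have happrox : ∀ r : ℝ≥0, r ≤ t →
      ∀ᵐ ω ∂P, |stoppedProcess Y σ r ω - (a * Q r ω + b)| ≤ ε / 2 * |a| := by
    intro r hr
    filter_upwards [hae, hW0] with ω hω h0
    set r' : ℝ≥0 := (min (r : WithTop ℝ≥0) (σ ω)).untopA with hr'
    have hr'r : r' ≤ r := untopA_min_coe_le r _
    have hr'σ : (r' : WithTop ℝ≥0) ≤ σ ω := coe_untopA_min_le r _
    have hbd : ∀ u, u ≤ r' → |W u ω| ≤ K := fun u hu ↦ by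
      have hu' : (u : WithTop ℝ≥0) ≤ σ ω := (WithTop.coe_le_coe.2 hu).trans hr'σ
      have h := abs_stoppedProcess_exitTime_le (hWc ω) h0 hK u
      rwa [stoppedProcess_eq_of_le hu'] at h
    exact hω r' (hr'r.trans hr) hbd
  have h := integral_abs_condExp_sub_le_of_approx hYσ hst (hQint t) (hQint s) ha
    (happrox t le_rfl) (happrox s hst)
  calc ∫ ω, |(P[Q t | 𝓕 s]) ω - Q s ω| ∂P ≤ 2 * (ε / 2 * |a|) / |a| := h
    _ = ε := by field_simp

end Stopped

/-! ### Lévy's format: local martingale and quadratic variation -/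

section Local

variable {W : ℝ≥0 → Ω → ℝ} {𝓕 : Filtration ℝ≥0 m} {P : Measure Ω} [IsProbabilityMeasure P]

omit [IsProbabilityMeasure P] in
/-- Multiplying a martingale by the indicator of an a.s. sure `𝓕 ⊥`-event keeps it a martingale
(the indicator `𝟙_{⊥ < τ}` of Mathlib's `ProbabilityTheory.Locally`). [folklore] -/
theorem martingale_indicator_of_ae_mem {M : ℝ≥0 → Ω → ℝ} (hM : Martingale M 𝓕 P) {S : Set Ω}
    (hS : MeasurableSet[𝓕 ⊥] S) (hae : ∀ᵐ ω ∂P, ω ∈ S) :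
    Martingale (fun i ↦ S.indicator (M i)) 𝓕 P := by
  refine hM.congr (fun i ↦ (hM.stronglyAdapted i).indicator (𝓕.mono bot_le _ hS)) fun i ↦ ?_
  filter_upwards [hae] with ω hω
  rw [Set.indicator_of_mem hω]

/-- **Local martingale and quadratic variation from approximating observables.** Let `W` be a real
process indexed by `ℝ≥0`, adapted to `𝓕`, with continuous paths and `W_0 = 0` a.s., and let
`κ > 0`. Suppose that for every level `K > 0`, horizon `T` and `ε > 0` there are continuous
`𝓕`-martingales approximating `W_r` (order one) and `W_r² - κ r` (order two) affinely within
`ε |a|` on the paths with `|W| ≤ K` on `[0, r]`, `r ≤ T` (the two far-field channels of a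
martingale observable; CDHKS 2014, §3: "we can exchange the asymptotic expansion with the
conditional expectation and conclude that both coefficients … are martingales"). Then
`X = W/√κ` is a continuous local martingale with quadratic variation `⟨X⟩_t = t`
(`IsLocalMartingale`, `HasQuadraticVariation`, localising sequence the exit times of `W` from
`(-(n+1), n+1)`) — the hypothesis format of Lévy's characterisation
(`Process.levy_characterisation_holds`). No moment hypothesis on `W`. [cite: CDHKSCRAS2014, §3] -/
theorem isLocalMartingale_hasQuadraticVariation_of_approx (hWad : Adapted 𝓕 W)
    (hWc : ∀ ω, Continuous (W · ω)) (hW0 : ∀ᵐ ω ∂P, W 0 ω = 0) {κ : ℝ≥0} (hκ : 0 < κ)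
    (h1 : ∀ K : ℝ, 0 < K → ∀ T : ℝ≥0, ∀ ε : ℝ, 0 < ε → ∃ (Y : ℝ≥0 → Ω → ℝ) (a b : ℝ), a ≠ 0 ∧
      Martingale Y 𝓕 P ∧ (∀ ω, Continuous (Y · ω)) ∧ ∀ᵐ ω ∂P, ∀ r : ℝ≥0, r ≤ T →
        (∀ u, u ≤ r → |W u ω| ≤ K) → |Y r ω - (a * W r ω + b)| ≤ ε * |a|)
    (h2 : ∀ K : ℝ, 0 < K → ∀ T : ℝ≥0, ∀ ε : ℝ, 0 < ε → ∃ (Y : ℝ≥0 → Ω → ℝ) (a b : ℝ), a ≠ 0 ∧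
      Martingale Y 𝓕 P ∧ (∀ ω, Continuous (Y · ω)) ∧ ∀ᵐ ω ∂P, ∀ r : ℝ≥0, r ≤ T →
        (∀ u, u ≤ r → |W u ω| ≤ K) → |Y r ω - (a * (W r ω ^ 2 - (κ : ℝ) * r) + b)| ≤ ε * |a|) :
    RandomPlanarGeometry.IsLocalMartingale (fun t ω ↦ (Real.sqrt κ)⁻¹ * W t ω) 𝓕 P ∧
      HasQuadraticVariation (fun t ω ↦ (Real.sqrt κ)⁻¹ * W t ω) (fun t _ ↦ (t : ℝ)) 𝓕 P := by
  set τ : ℕ → Ω → WithTop ℝ≥0 := fun n ↦ exitTime W (-((n : ℝ) + 1)) ((n : ℝ) + 1) with hτ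
  have hloc : IsLocalizingSequence 𝓕 τ P := isLocalizingSequence_exitTime hWad hWc
  have hLn : ∀ n : ℕ, (0 : ℝ) < n + 1 := fun n ↦ by positivity
  have hκ' : (0 : ℝ) < κ := by exact_mod_cast hκ
  set c : ℝ := (Real.sqrt κ)⁻¹ with hc
  have hc2 : c ^ 2 = (κ : ℝ)⁻¹ := by rw [hc, inv_pow, Real.sq_sqrt hκ'.le]
  -- the events `{⊥ < τ n}` are a.s. sure and `𝓕 ⊥`-measurable
  have hS : ∀ n, MeasurableSet[𝓕 ⊥] {ω | ⊥ < τ n ω} := fun n ↦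
    (hloc.isStoppingTime n).measurableSet_bot_lt
  have hSae : ∀ n, ∀ᵐ ω ∂P, ω ∈ {ω | ⊥ < τ n ω} := fun n ↦ by
    filter_upwards [hW0] with ω h0
    exact bot_lt_exitTime (hWc ω) h0 (hLn n)
  -- the stopped martingales at level `n + 1`
  have hV : ∀ n, Martingale (stoppedProcess W (τ n)) 𝓕 P := fun n ↦
    martingale_stoppedDriver_of_approx hWad hWc hW0 (hLn n) (h1 _ (hLn n))
  have hQ : ∀ n, Martingale (fun r ω ↦ stoppedProcess W (τ n) r ω ^ 2 -
      (κ : ℝ) * (((min (r : WithTop ℝ≥0) (τ n ω)).untopA : ℝ≥0) : ℝ)) 𝓕 P := fun n ↦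
    martingale_stoppedQuad_of_approx hWad hWc hW0 (hLn n) (κ : ℝ) (h2 _ (hLn n))
  have hM1 : RandomPlanarGeometry.IsLocalMartingale (fun t ω ↦ c * W t ω) 𝓕 P := by
    refine ⟨τ, hloc, fun n ↦ ?_⟩
    have key := martingale_indicator_of_ae_mem ((hV n).smul c) (hS n) (hSae n)
    convert key using 1
    funext i ω
    simp only [stoppedProcess, Set.indicator_apply, Set.mem_setOf_eq, Pi.smul_apply, smul_eq_mul]
  have hM2 : RandomPlanarGeometry.IsLocalMartingale (fun t ω ↦ (c * W t ω) ^ 2 - (t : ℝ)) 𝓕 P := by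
    refine ⟨τ, hloc, fun n ↦ ?_⟩
    have key := martingale_indicator_of_ae_mem ((hQ n).smul (κ : ℝ)⁻¹) (hS n) (hSae n)
    convert key using 1
    funext i ω
    simp only [stoppedProcess, Set.indicator_apply, Set.mem_setOf_eq, Pi.smul_apply, smul_eq_mul]
    rw [mul_pow, hc2, mul_sub, ← mul_assoc, inv_mul_cancel₀ hκ'.ne', one_mul]
  exact ⟨hM1,
    { adapted := fun _ ↦ measurable_const
      continuous := ae_of_all _ fun _ ↦ NNReal.continuous_coe
      monotone := ae_of_all _ fun _ _ _ h ↦ NNReal.coe_le_coe.2 h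
      zero := fun _ ↦ NNReal.coe_zero
      isLocalMartingale := hM2 }⟩

end Local

end Literature.Probability.Process
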